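import Mathlib
import Summits.MatrixMultiplication.MatrixMultiplication.Theses.SnSubsetDichotomy
import Literature.Barriers.MatrixMultiplication.NilpotentGroupBarrierSemisimple
import Literature.Barriers.MatrixMultiplication.NilpotentGroupBarrierGradedCoords

/-!
# Line `klr-graded-polynomial-method` — crux `NoThresholdSubsetTriple` (stmt-MatrixMultiplication-8302)

Crux (route `SnSubsetDichotomy`, FIXED): `∃ c > 0, n₀, ∀ n ≥ n₀`, every TPP triple `S, T, U ⊆ S_n` has
`|S||T||U| ≤ (n!)^{3/2}·e^{-c√n}`.

THE LINE (merged KLR line of the round-1 panel: idea `klr-graded-polynomial-method` ≈ `klr-graded-codimension`,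
TRIAGE-r1-1/2/3): the slice-rank ("polynomial") method in characteristic `p`, fed by the Brundan–Kleshchev /
Hu–Mathas `ℤ`-GRADING of the group algebra `𝔽_p S_n ≅ R^{Λ₀}_n` (cyclotomic KLR algebra).

* TRANSFER `C⁺` (`ModularSliceRankSaving`, BCCGU17 §6's conjecture for `S_n` in its weak `e^{-c√n}` form):
  `slice-rank_{𝔽_p} D_{S_n} ≤ n!·e^{-c√n}` for large `n` ⟹ crux (`stub_savingTransfer`, provable now: a threshold
  TPP triple is balanced by packing, a balanced TPP triple of `m`-sets embeds `⟨m,m,m⟩`, whose slice rank is `m²`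
  over every field — tree theorem `BCCGU2017_propB6_holds` / `BCCGU2017_propB6.sq_le_sliceRank_of_realizesTPP`).
* CODIMENSION BOUND (`GradedCodimBound` = BCCGU17 Prop. 3.2 for `ℤ`-graded block bases, `stub_gradedCodim`,
  provable now from the tree's `HasSliceRankLE.of_graded` + `subst_*`): a basis `β` of `K[G]` with
  `β_i β_j ∈ span{β_k : same block, deg k = deg i + deg j}` gives, for every block-dependent cut `a`,
  `slice-rank D_G ≤ 2·#{deg < a} + #{deg ≥ 2a}` (negative degrees allowed: no shift is needed because only
  `V_{≥a}·V_{≥a} ⊆ V_{≥2a}` is used).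
* THE KLR INPUT (`KLRGradedBasis`, `stub_klrGradedBasis`; KNOWN THEOREM — Brundan–Kleshchev 2009 (blocks of
  `𝔽_p S_n` are cyclotomic KLR algebras, graded) + Hu–Mathas 2010 (homogeneous cellular basis `ψ_{ST}`,
  `deg ψ_{ST} = deg_p S + deg_p T`) + Brundan–Kleshchev–Wang 2011 (the tableau degree `deg_p`) — to be vendored
  as ONE Literature named fact; stated here over the explicit combinatorial definitions `StdTableau`, `TabPair`,
  `StdTableau.deg` of §D1): `𝔽_p[S_n]` has a basis indexed by same-shape pairs of standard tableaux which is
  multiplicative for (residue content, `deg_p S + deg_p T`).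
* THE OPEN HEART (`KLRDegreeTails`, `stub_klrDegreeTails`, HARDEST): for some prime `p` (numerically `p = 2`) and
  `c > 0`, block-dependent cuts make BOTH tails of the integer statistic `X = deg_p S + deg_p T` over the `n!` pairs
  small: `2·#{X < a_B} + #{X ≥ 2a_B} ≤ n!·e^{-c√n}` — a moderate-deviation estimate at `n^{1/4}` standard
  deviations for the BKW degree of a Plancherel-random pair of tableaux (measured: `sd(X - w_B) ≈ 0.72·n^{3/4}`,
  window `w_B/3 ≈ n/6`; exact tensor-power exponent `-log ρ₂(n)/√n ≈ 0.021`, flat for `18 ≤ n ≤ 46`,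
  independently replicated by all three triagers).

COMPOSITION (kernel-checked, no sorry of its own): `saving_of : KLRGradedBasis → GradedCodimBound → KLRDegreeTails →
ModularSliceRankSaving` (basis + codimension bound + tails ⟹ `C⁺` with the same `c`), and
`NoThresholdSubsetTriple_of : NoThresholdSubsetTriple := stub_savingTransfer (saving_of stub_… stub_… stub_…)` — the crux BY
NAME from exactly the four registered `stub_*` (the only sorries in the file).

DISPROOF USED (cdisprove v6, by theorem name; file not importable from this seat): `false_without_TPP` and
`false_with_pairwise_only` are honoured at `stub_savingTransfer` (the lower bound `m² ≤ slice-rank` needs the GENUINE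
triple product property: it is the coordinate restriction `⟨m,m,m⟩ ≤ D_{S_n}`, unavailable from pairwise conditions);
`holds_without_posConst` / `packing_bound` (all content is in `c > 0`): our `c` is produced by `stub_klrDegreeTails`;
`false_without_n0`: `n₀` comes from the tails stub; `crux_holds_for_young_triples`, `card_gt/lt_of_threshold`
(threshold triples are balanced) are consistent with / re-derived inside the transfer. No `Negative/` lemma has
landed for this crux (checked 2026-08-16), so no stub is an instance of a refuted statement; `ledger negatives`
(3 entries) do not concern `S_n`.
-/

set_option linter.dupNamespace false

noncomputable section

open scoped BigOperators

namespace Summit.MatrixMultiplication.MatrixMultiplication.Cruxes.NoThresholdSubsetTriple.KlrGradedPolynomialMethod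

open Summit.MatrixMultiplication.MatrixMultiplication.Theses.SnSubsetDichotomy

/-! ## D1. Standard tableaux, residues and the Brundan–Kleshchev–Wang degree (definitions)

A standard Young tableau with `n` cells is recorded by its growth sequence: `box k` is the cell (row, column),
0-based, English convention (row index grows DOWNWARDS), that receives the entry `k + 1`. All cells of an
`n`-cell diagram have coordinates `< n`, so `Fin n × Fin n` suffices and every type below is finite. -/

section Tableaux

variable {n : ℕ}

/-- `box : Fin n → Fin n × Fin n` is the growth sequence of a standard Young tableau: cells are distinct, and
each new cell `(r, c)` is supported from above (`r = 0` or `(r-1, c)` came earlier) and from the left (`c = 0` or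
`(r, c-1)` came earlier). Equivalently every prefix is a Young diagram and entries increase along rows and
columns. -/
def IsStdTableau (box : Fin n → Fin n × Fin n) : Prop :=
  Function.Injective box ∧
    ∀ k : Fin n,
      (((box k).1 : ℕ) = 0 ∨
          ∃ k' : Fin n, k' < k ∧ ((box k').1 : ℕ) + 1 = (box k).1 ∧ (box k').2 = (box k).2) ∧
        (((box k).2 : ℕ) = 0 ∨
          ∃ k' : Fin n, k' < k ∧ (box k').1 = (box k).1 ∧ ((box k').2 : ℕ) + 1 = (box k).2)

variable (n) in
/-- Standard Young tableaux with `n` cells (all shapes `λ ⊢ n` at once; the shape is the set of cells). -/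
structure StdTableau where
  /-- growth sequence: the cell of the entry `k + 1` -/
  box : Fin n → Fin n × Fin n
  isStd : IsStdTableau box

instance : Finite (StdTableau n) :=
  Finite.of_injective StdTableau.box fun T T' h => by
    cases T; cases T'; cases h; rfl

namespace StdTableau

/-- The cell of the entry `k + 1`, as a pair of naturals `(row, column)`. -/
def cell (T : StdTableau n) (k : Fin n) : ℕ × ℕ := (((T.box k).1 : ℕ), ((T.box k).2 : ℕ))

/-- The shape of the sub-tableau of entries `1, …, k + 1` (a Young diagram, as a set of cells). -/
def shapeLE (T : StdTableau n) (k : Fin n) : Finset (ℕ × ℕ) :=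
  (Finset.univ.filter fun k' : Fin n => k' ≤ k).image T.cell

/-- The shape of `T` (set of its `n` cells). -/
def shape (T : StdTableau n) : Finset (ℕ × ℕ) := Finset.univ.image T.cell

end StdTableau

/-- The `p`-residue of a cell `(r, c)`: `c - r (mod p)`. -/
def res (p : ℕ) (x : ℕ × ℕ) : ZMod p := (x.2 : ZMod p) - (x.1 : ZMod p)

/-- Addable node of a Young diagram `μ` (given as its set of cells): a cell outside `μ` supported from above and
from the left. -/
def IsAddable (μ : Finset (ℕ × ℕ)) (x : ℕ × ℕ) : Prop :=
  x ∉ μ ∧ (x.1 = 0 ∨ (x.1 - 1, x.2) ∈ μ) ∧ (x.2 = 0 ∨ (x.1, x.2 - 1) ∈ μ)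

/-- Removable node of a Young diagram `μ`: a cell of `μ` with no cell below it and none to its right. -/
def IsRemovable (μ : Finset (ℕ × ℕ)) (x : ℕ × ℕ) : Prop :=
  x ∈ μ ∧ (x.1 + 1, x.2) ∉ μ ∧ (x.1, x.2 + 1) ∉ μ

instance (μ : Finset (ℕ × ℕ)) (x : ℕ × ℕ) : Decidable (IsAddable μ x) := by
  unfold IsAddable; infer_instance

instance (μ : Finset (ℕ × ℕ)) (x : ℕ × ℕ) : Decidable (IsRemovable μ x) := by
  unfold IsRemovable; infer_instance

namespace StdTableau

/-- The Brundan–Kleshchev–Wang degree increment at the entry `k + 1` (BKW 2011 §3; Hu–Mathas 2010 §3): with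
`μ = shape(T restricted to 1..k+1)` and `A` the cell of `k + 1` (a removable node of `μ`, residue `i = res A`),
`d_A(μ) = #{addable i-nodes of μ strictly below A} − #{removable i-nodes of μ strictly below A}`
("below" = larger row index). All candidate nodes have coordinates `≤ n`. -/
def degStep (p : ℕ) (T : StdTableau n) (k : Fin n) : ℤ :=
  ((((Finset.range (n + 1)) ×ˢ (Finset.range (n + 1))).filter fun B =>
        IsAddable (T.shapeLE k) B ∧ res p B = res p (T.cell k) ∧ (T.cell k).1 < B.1).card : ℤ) -
    ((((Finset.range (n + 1)) ×ˢ (Finset.range (n + 1))).filter fun B =>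
        IsRemovable (T.shapeLE k) B ∧ res p B = res p (T.cell k) ∧ (T.cell k).1 < B.1).card : ℤ)

/-- The Brundan–Kleshchev–Wang `p`-degree of a standard tableau: `deg_p T = Σ_k d_{A_k}(μ_k)` over its growth
sequence (an INTEGER; e.g. `p = 2`, shape `(2,1)`, `T = [1 3 / 2]` has degree `-1`; shape `(2)`: degree `1`;
shape `(1,1)`: degree `0`, matching `𝔽₂S₂ = 𝔽₂[y]/(y²)`, `deg y = 2`). -/
def deg (p : ℕ) (T : StdTableau n) : ℤ := ∑ k : Fin n, T.degStep p k

/-- Residue content of (the shape of) `T`: the number of cells of each `p`-residue. Two shapes lie in the same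
block of `𝔽_p S_n` iff their residue contents agree (Nakayama's conjecture, = same `p`-core). -/
def content (p : ℕ) (T : StdTableau n) (i : ZMod p) : ℕ :=
  (Finset.univ.filter fun k : Fin n => res p (T.cell k) = i).card

end StdTableau

variable (n) in
/-- Pairs of standard tableaux of the same shape with `n` cells — the index set of the Murphy / Hu–Mathas
cellular bases of `K[S_n]` (`Σ_λ f_λ² = n!`, Robinson–Schensted). -/
structure TabPair where
  /-- first tableau -/
  S : StdTableau n
  /-- second tableau, of the same shape -/
  T : StdTableau n
  shape_eq : S.shape = T.shape

instance : Finite (TabPair n) :=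
  Finite.of_injective (fun x : TabPair n => (x.S, x.T)) fun x y h => by
    cases x; cases y
    simp only [Prod.mk.injEq] at h
    obtain ⟨h₁, h₂⟩ := h
    subst h₁; subst h₂; rfl

namespace TabPair

/-- The graded degree of the basis vector `ψ_{ST}`: `deg_p S + deg_p T` (Hu–Mathas 2010). This is the integer
statistic `X_p` of the card (via RSK, a statistic of a uniformly random permutation). -/
def deg (p : ℕ) (x : TabPair n) : ℤ := x.S.deg p + x.T.deg p

/-- The block label of `ψ_{ST}`: the residue content of the common shape. -/
def content (p : ℕ) (x : TabPair n) : ZMod p → ℕ := x.S.content p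

end TabPair

end Tableaux

/-! ## The stubs -/

/-- **K3 — the KLR graded basis (KNOWN THEOREM, to be vendored as a Literature named fact).**
Brundan–Kleshchev 2009 (Invent. Math. 178, arXiv:0808.2032, Main Theorem: `𝔽 S_n`-blocks ≅ cyclotomic KLR
algebras `R^{Λ₀}_α`, `e = char 𝔽 = p`, hence `𝔽_p S_n` is `ℤ`-graded) + Hu–Mathas 2010 (Adv. Math. 225,
arXiv:0907.2985, Main Theorem / Thm. 5.8: `{ψ_{ST}}` over same-shape pairs of standard tableaux is a HOMOGENEOUS
cellular basis with `deg ψ_{ST} = deg S + deg T`) + Brundan–Kleshchev–Wang 2011 (Crelle 655, arXiv:0901.0218, §3: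
the tableau degree `deg`), transported to the group algebra: for every prime `p` and every `n` there is a basis
`β` of `𝔽_p[S_n]` indexed by `TabPair n` such that `β_i β_j` lies in the span of the `β_k` with the SAME residue
content (same block; products across blocks vanish) and `deg k = deg i + deg j` (homogeneity). Formalising the
proof is far out of reach (XL); the line is conditional on this fact until it is vendored. -/
def KLRGradedBasis : Prop :=
  ∀ (p : ℕ) [Fact p.Prime] (n : ℕ),
    ∃ β : Module.Basis (TabPair n) (ZMod p) (MonoidAlgebra (ZMod p) (Equiv.Perm (Fin n))),
      ∀ i j : TabPair n,
        β i * β j ∈ Submodule.span (ZMod p)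
          (β '' {k | k.content p = i.content p ∧ k.content p = j.content p ∧
            k.deg p = i.deg p + j.deg p})

/-- stub · K3 · known theorem (BK09 + HM10 + BKW11), named-fact flavour; see `KLRGradedBasis`. -/
theorem stub_klrGradedBasis : KLRGradedBasis := by
  sorry

/-- **K1 — the codimension bound for `ℤ`-graded block bases (BCCGU17 Prop. 3.2 / Prop. 13; PROVABLE NOW).**
If `β` is a basis of `K[G]` indexed by `Λ`, `deg : Λ → ℤ`, `blk : Λ → Blk`, and every product `β_i β_j` lies in
`span{β_k : blk k = blk i = blk j, deg k = deg i + deg j}`, then for every block-dependent cut `a : Blk → ℤ`,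
`slice-rank_K D_G ≤ 2·#{i : deg i < a(blk i)} + #{k : 2·a(blk k) ≤ deg k}` (`D_G(x,y,z) = [xyz = 1]`, the tree's
`mulGroupTensor`). Proof route (≈ M): coordinates `P i x = (β i) x`, `Q x i = β.repr x i` as in the tree's
`GradedCoords.ofBasis`; the structure constants satisfy `c'(i,j;k) ≠ 0 → blk k = blk i = blk j ∧ deg k =
deg i + deg j`; apply the tree's `HasSliceRankLE.of_graded` with the THREE degree functions
`dx i = dy i = [a(blk i) ≤ deg i] ∈ {0,1}`, `dz k = 1 + [2a(blk k) ≤ deg k] ∈ {1,2}` and the cut `(1,1)`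
(this is how negative degrees are handled: no shift, only `V_{≥a}·V_{≥a} ⊆ V_{≥2a}` blockwise), then
`subst_left/mid/right` exactly as in `GradedCoords.hasSliceRankLE`, and `Fintype.card ↔ Nat.card`. -/
def GradedCodimBound : Prop :=
  ∀ (K : Type) [Field K] (G : Type) [Group G] [Fintype G] [DecidableEq G] (Λ : Type) [Finite Λ]
    (Blk : Type) (β : Module.Basis Λ K (MonoidAlgebra K G)) (deg : Λ → ℤ) (blk : Λ → Blk),
    (∀ i j : Λ, β i * β j ∈ Submodule.span K
        (β '' {k | blk k = blk i ∧ blk k = blk j ∧ deg k = deg i + deg j})) →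
      ∀ a : Blk → ℤ,
        Literature.Barriers.MatrixMultiplication.sliceRank
            (Literature.Barriers.MatrixMultiplication.mulGroupTensor K G) ≤
          2 * Nat.card {i : Λ // deg i < a (blk i)} + Nat.card {k : Λ // 2 * a (blk k) ≤ deg k}

/-- stub · K1 · provable now (tree: `HasSliceRankLE.of_graded`, `.subst_left/mid/right`, `GradedCoords.ofBasis`
pattern, `hasSliceRankLE_iff_sliceRank_le`); see `GradedCodimBound`. -/
theorem stub_gradedCodim : GradedCodimBound := by
  sorry

/-- **K2 — graded tails of `𝔽_p S_n` (THE CRUX OF THE LINE; OPEN).** For some prime `p` and `c > 0`, for all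
large `n` there are block-dependent cuts `a_B ∈ ℤ` (block `B` = residue content; intended `a_B = ⌈2w_B/3⌉`,
`w_B` the `p`-weight = defect of the block) such that
`2·#{(S,T) : deg_p S + deg_p T < a_B} + #{(S,T) : deg_p S + deg_p T ≥ 2a_B} ≤ n!·e^{-c√n}`,
the pairs `(S,T)` ranging over same-shape pairs of standard tableaux with `n` cells (`n!` of them). Informally: the
statistic `X = deg_p S + deg_p T`, palindromic about `w_B` on each block (graded symmetry), has two-sided tails
`P(|X - w_B| ≥ w_B/3) ≤ e^{-c√n}` under the uniform (= Plancherel ⊗ uniform-tableau²) measure — a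
moderate-deviation bound at `n^{1/4}` standard deviations (measured `sd ≈ 0.72 n^{3/4}`, window `≈ n/(3p)`).
Why it might fail: the drift part `E[X | shape]` is a Plancherel shape functional whose lower tail could be
stretched-exponential with exponent `< 1/2` in `√n`-units (then only `e^{-c n^{1/4}}`-type savings follow and the
line dies for THIS crux, degrading to the route's `PolynomialSlack`). Any prime works for the composition; the
numerics favour `p = 2`. -/
def KLRDegreeTails : Prop :=
  ∃ p : ℕ, p.Prime ∧ ∃ c : ℝ, 0 < c ∧ ∃ n₀ : ℕ, ∀ n ≥ n₀, ∃ a : (ZMod p → ℕ) → ℤ,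
    (2 * (Nat.card {i : TabPair n // i.deg p < a (i.content p)} : ℝ) +
        (Nat.card {k : TabPair n // 2 * a (k.content p) ≤ k.deg p} : ℝ)) ≤
      (n.factorial : ℝ) * Real.exp (-(c * Real.sqrt (n : ℝ)))

/-- stub · K2 · OPEN (hardest; the whole difficulty of the line, by design explicit and numerically shadowed);
see `KLRDegreeTails`. -/
theorem stub_klrDegreeTails : KLRDegreeTails := by
  sorry

/-- **C⁺ — modular slice-rank saving for `S_n`** (Blasiak–Church–Cohn–Grochow–Umans 2017, §6: "the most
ambitious conjecture regarding the symmetric group", in its weakest `e^{-c√n}` form, over a prime field):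
`∃ c > 0, n₀, ∀ n ≥ n₀, ∃ p prime, slice-rank_{𝔽_p} D_{S_n} ≤ n!·e^{-c√n}`. Host-free: it bounds every TPP
subset triple (and every multiplicative matching) of `S_n` at once. -/
def ModularSliceRankSaving : Prop :=
  ∃ c : ℝ, 0 < c ∧ ∃ n₀ : ℕ, ∀ n ≥ n₀, ∃ p : ℕ, p.Prime ∧
    (Literature.Barriers.MatrixMultiplication.sliceRank
        (Literature.Barriers.MatrixMultiplication.mulGroupTensor (ZMod p) (Equiv.Perm (Fin n))) : ℝ) ≤
      (n.factorial : ℝ) * Real.exp (-(c * Real.sqrt (n : ℝ)))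

/-- stub · TRANSFER · provable now (≈ M): `C⁺ ⟹ crux` with `c_crux = c/4`, `n₀' = max n₀ 1`. Given a TPP triple
with `|S||T||U| > (n!)^{3/2} e^{-(c/4)√n}` (else done): packing (`RealizesTPP.mul_le_card` applied to the three
cyclic rotations of the TPP: `|S||T|, |T||U|, |U||S| ≤ n!`) makes it balanced, each set `≥ m := ⌈√(n!)·e^{-(c/4)√n}⌉`;
shrink to three `m`-subsets (`Finset.exists_subset_card_eq`, TPP hereditary: `TripleProductProperty.mono`), so
`RealizesTPP (Equiv.Perm (Fin n)) m m m` and, with `haveI := Fact.mk hp`,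
`m² ≤ sliceRank (mulGroupTensor (ZMod p) _)` (tree THEOREM
`BCCGU2017_propB6_holds.sq_le_sliceRank_of_realizesTPP`) `≤ n!·e^{-c√n}`, contradicting
`m² ≥ n!·e^{-(c/2)√n} > n!·e^{-c√n}` (`n ≥ 1`). Uses the GENUINE triple product property (answers
`false_with_pairwise_only`, `false_without_TPP` of Disproof.lean). -/
def SavingTransfer : Prop :=
  ModularSliceRankSaving → NoThresholdSubsetTriple

/-- stub · TRANSFER · provable now; see `SavingTransfer` (= `ModularSliceRankSaving → NoThresholdSubsetTriple`). -/
theorem stub_savingTransfer : SavingTransfer := by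
  sorry

/-! ## Composition (kernel-checked, no sorry of its own): the stubs imply the crux BY NAME -/

/-- The graded half of the line: basis (K3) + codimension bound (K1) + graded tails (K2) give the modular
slice-rank saving `C⁺` with the same constant `c` and the prime of K2. Real proof (bookkeeping only). -/
theorem saving_of (hB : KLRGradedBasis) (hC : GradedCodimBound) (hT : KLRDegreeTails) :
    ModularSliceRankSaving := by
  obtain ⟨p, hp, c, hc, n₀, hn⟩ := hT
  refine ⟨c, hc, n₀, fun n hn' => ⟨p, hp, ?_⟩⟩
  obtain ⟨a, ha⟩ := hn n hn'
  haveI : Fact p.Prime := ⟨hp⟩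
  obtain ⟨β, hβ⟩ := hB p n
  have h := hC (ZMod p) (Equiv.Perm (Fin n)) (TabPair n) (ZMod p → ℕ) β (TabPair.deg p)
    (TabPair.content p) hβ a
  have h' : (Literature.Barriers.MatrixMultiplication.sliceRank
      (Literature.Barriers.MatrixMultiplication.mulGroupTensor (ZMod p) (Equiv.Perm (Fin n))) : ℝ) ≤
      ((2 * Nat.card {i : TabPair n // TabPair.deg p i < a (TabPair.content p i)} +
        Nat.card {k : TabPair n // 2 * a (TabPair.content p k) ≤ TabPair.deg p k} : ℕ) : ℝ) := by
    exact_mod_cast h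
  refine h'.trans ?_
  push_cast
  exact ha

/-- THE SKELETON: `stub_klrGradedBasis → stub_gradedCodim → stub_klrDegreeTails → stub_savingTransfer → crux`,
i.e. `NoThresholdSubsetTriple` follows from the four registered stubs (the only sorries of this file) through
`saving_of` and the transfer; the conclusion is the route decl
`Summit.MatrixMultiplication.MatrixMultiplication.Theses.SnSubsetDichotomy.NoThresholdSubsetTriple` by name. -/
theorem NoThresholdSubsetTriple_of :
    Summit.MatrixMultiplication.MatrixMultiplication.Theses.SnSubsetDichotomy.NoThresholdSubsetTriple :=
  (show ModularSliceRankSaving → NoThresholdSubsetTriple from stub_savingTransfer)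
    (saving_of stub_klrGradedBasis stub_gradedCodim stub_klrDegreeTails)

end Summit.MatrixMultiplication.MatrixMultiplication.Cruxes.NoThresholdSubsetTriple.KlrGradedPolynomialMethod

end
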